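import Summits.ABC.IUTFork.LDHGenuine
import Literature.IUT.LogVolume.TensorPacketLicenceExact
import Literature.IUT.LogVolume.TensorPacketStepVWith

/-!
# LENS L8 (requirement side) — the IDENTIFICATION SOCKET at [IUTchIII] Cor. 3.12 as typed in our tree

Sketch for the crux idea card `identification-socket` (crux stmt-ABC-19678 `IUTThetaPilot.ThetaPartII`).
TAKES NO SIDE on [IUTchIII] Cor. 3.12 (D-0045). An identification object PROPOSED is not IUT repaired; typed ≠ proved;
NO abc claim. Every `def … : Prop` below is a STATEMENT, asserted nowhere; the `theorem`s are bookkeeping over the two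
`Prop`-valued axioms PRICE and ANCHOR.

The socket: the minimal data + axioms an object ("alien" or print's) must supply so that the RESHAPE-4 squeeze
`gap(I) := deĝ̲_lgp(P_Θ) − deĝ̲(P_q) ≤ δ (+ arch)` — the only thing the crux's kernel tail
`ThetaPartIIDisplay.ThetaPartII_of_squeezeIII` consumes — goes through at a genuine Θ-volume input `I`.
-/

noncomputable section

namespace Summit.ABC.ABC.Cruxes.ThetaPartII.IdentificationSocket

open Literature.IUT.LogVolume NumberField IsDedekindDomain Set
open scoped Pointwise

variable {F₀ : Type} [Field F₀] [NumberField F₀] {K : Type} [Field K] [NumberField K] [Algebra F₀ K]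

/-- (S1) the CARRIER type: a Θ-side container, one region of `𝕃_p` (a subset of every summand `X_{v⃗}`, `v⃗ ∈ V(F₀)_p^{j+1}`)
per support prime — the slot print fills with `hull(U_Θ)_p = possibleImagesHull (pilotRegion t_Θ)`. -/
abbrev Container (I : ThetaVolumeInput F₀ K) : Type :=
  ∀ (p : ℕ) (hp : p.Prime), (I.packetAt p hp).Region

/-- The Θ-side log-volume functional of a container: `Σ_{p ∈ T(I)} ln ν̄_{𝕃_p}(R_p)` (same bookkeeping as
`ThetaVolumeInput.negLogThetaNonarch`, which is this functional at print's container, `vol_print`). -/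
def vol (I : ThetaVolumeInput F₀ K) (R : Container I) : ℝ :=
  ∑ p ∈ I.supportPrimes, if hp : p.Prime then (I.packetAt p hp).lnνLp I.lstar (R p hp) else 0

/-- Print's container: the holomorphic hull of the union of the possible images of the Θ-pilot region under the typed
(Ind1) = `𝔖_{j+1}`, (Ind2) = `G₂(v⃗)` ([IUTchIII] Cor. 3.12; Dupuy–Hilado §4.11–4.12). -/
def printContainer (I : ThetaVolumeInput F₀ K) : Container I :=
  fun p hp => (I.packetAt p hp).possibleImagesHull ((I.packetAt p hp).pilotRegion (I.tΘ p hp))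

/-- `vol` at print's container is the tree's `negLogThetaNonarch` (definitional bookkeeping). -/
theorem vol_print (I : ThetaVolumeInput F₀ K) : vol I (printContainer I) = I.negLogThetaNonarch := by
  unfold vol printContainer ThetaVolumeInput.negLogThetaNonarch
  refine Finset.sum_congr rfl fun p _ => ?_
  by_cases hp : p.Prime
  · rw [dif_pos hp, I.negLogThetaLoc_of_prime hp]
    rfl
  · rw [dif_neg hp, ThetaVolumeInput.negLogThetaLoc, dif_neg hp]

/-- **THE IDENTIFICATION SOCKET** (lens L8: minimal axioms). An inhabitant is ANY object — print's multiradial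
container or an "alien" one — presented through what Cor. 3.12's proof-as-typed actually consumes:
* (S1) `R`      — a Θ-side container (carrier);
* (S2) `adm`, `hull_closed` — legitimacy: measurable (else `ln ν̄` is a junk value) and equal to its own holomorphic hull
  (H2: log-volumes are only comparable on hull-closed regions, [IUTchIII] Rmk. 3.9.5);
* (S3) `theta_subset` — Θ-GENERATION: the Θ-pilot region is one of the possible images (the object identifies Θ, not
  some unrelated region);
* (S4) `G`, `orbit_subset` — DECLARED INDETERMINACY BOOKKEEPING: a declared subgroup of the typed (Ind2) group under whose
  orbit of the Θ-region the container is closed (the declared blur; `⊤` for print, possibly smaller for an alien object —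
  never an undeclared enlargement);
* (S5) `price`  — the PRICE axiom: a UNIFORM Θ-side volume bound `vol R ≤ −deĝ̲_lgp(P_Θ) + δ` ([IUTchIV] Thm. 1.10 shape;
  "T linear" = `δ` affine in log-diff + log-cond with slope `(l+1)/4·(1+O(1/l))`);
* (S6) `anchor` — the ANCHOR axiom (GLOBAL form): `−|log(q)| ≤ vol R` — the identification proper, the disputed step
  for print's container (`Cor312NonarchOf`), asserted nowhere in the tree.
Nothing else is consumed: `gap_le_of_socket`. -/
structure Socket (I : ThetaVolumeInput F₀ K) (δ : ℝ) : Type where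
  /-- (S1) carrier -/
  R : Container I
  /-- (S2a) admissible (measurable) summand by summand -/
  adm : ∀ p hp, (I.packetAt p hp).RegionAdm (R p hp)
  /-- (S2b) hull-closed (H2) -/
  hull_closed : ∀ p hp j e, (I.packetAt p hp).hullLoc j e (R p hp j e) = R p hp j e
  /-- (S3) Θ-generation -/
  theta_subset : ∀ p hp j e, (I.packetAt p hp).pilotRegion (I.tΘ p hp) j e ⊆ R p hp j e
  /-- (S4a) the DECLARED indeterminacy group, inside the typed (Ind2) -/
  G : ∀ p hp j e, Subgroup ((I.packetAt p hp).G₂ j e)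
  /-- (S4b) closure of the container under the declared orbit of the Θ-region -/
  orbit_subset : ∀ p hp j e (g : (I.packetAt p hp).G₂ j e), g ∈ G p hp j e →
    g • (I.packetAt p hp).pilotRegion (I.tΘ p hp) j e ⊆ R p hp j e
  /-- (S5) PRICE (uniform Θ-side volume bound) -/
  price : vol I R ≤ -LgpDivisor.ndegLgp I.X.thetaPilot + δ
  /-- (S6) ANCHOR, global form (the identification) -/
  anchor : I.negAbsLogQ ≤ vol I R

/-- **Interface theorem (the only thing downstream consumes).** Any inhabitant of the socket at `I` with price `δ`
gives the squeeze `deĝ̲_lgp(P_Θ) − deĝ̲(P_q) ≤ δ` — the per-input form of the hypothesis of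
`ThetaPartIIDisplay.ThetaPartII_of_squeezeIII` (there with `δ = B_III(P,l)` and `+ archLogTheta l`). Two lines of
arithmetic: the socket carries NO other load. -/
theorem gap_le_of_socket {I : ThetaVolumeInput F₀ K} {δ : ℝ} (S : Socket I δ) :
    LgpDivisor.ndegLgp I.X.thetaPilot - FinDivisor.ndeg F₀ I.X.qPilot ≤ δ := by
  have h₁ := S.anchor
  have h₂ := S.price
  unfold ThetaVolumeInput.negAbsLogQ at h₁
  linarith

/-- The same in the currency of `gap_le_of_cor312Of_of_hullEstimateOf` (archimedean summand added; `π > 1`). -/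
theorem gap_le_arch_of_socket {I : ThetaVolumeInput F₀ K} {δ : ℝ} (S : Socket I δ) :
    LgpDivisor.ndegLgp I.X.thetaPilot - FinDivisor.ndeg F₀ I.X.qPilot ≤ δ + ThetaVolumeInput.archLogTheta I.l := by
  linarith [gap_le_of_socket S, ThetaVolumeInput.archLogTheta_pos I.l]

/-- **Print's pair is ONE inhabitant.** `Cor312NonarchOf I` (ANCHOR for print's container — DISPUTED, a hypothesis here)
and `HullEstimateOf I δ` (PRICE for print's container — [IUTchIV] Thm. 1.10 shape; per prime a tree THEOREM with the
explicit discrepancy `DHData.explicitDeltaAt`, `DHData.negLogThetaLoc_le`) fill the socket with `R := hull(U_Θ)`,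
`G := ⊤`; admissibility of the hull is the `hull_adm`-type datum, taken as a hypothesis. So the socket item is
WEAKER-OR-EQUAL than the RESHAPE-4 pair: every closer of (`stub_cor312Bad`, `stub_hullRegimeAboveBad`) closes it. -/
def socketOfPrint (I : ThetaVolumeInput F₀ K) {δ : ℝ}
    (hadm : ∀ p hp, (I.packetAt p hp).RegionAdm (printContainer I p hp))
    (h₁ : I.Cor312NonarchOf) (h₂ : I.HullEstimateOf δ) : Socket I δ where
  R := printContainer I
  adm := hadm
  hull_closed p hp j e := (I.packetAt p hp).hullLoc j e |>.idempotent _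
  theta_subset p hp j e :=
    ((I.packetAt p hp).subset_possibleImages _ j e).trans ((I.packetAt p hp).possibleImages_subset_hull _ j e)
  G _ _ _ _ := ⊤
  orbit_subset p hp j e g _ := by
    intro x hx
    have hx' : x ∈ (I.packetAt p hp).possibleImages ((I.packetAt p hp).pilotRegion (I.tΘ p hp)) j e := by
      unfold PrimePacket.possibleImages
      refine mem_iUnion.mpr ⟨g, mem_iUnion.mpr ⟨1, ?_⟩⟩
      refine Set.smul_set_mono ?_ hx
      intro y hy
      exact ⟨y, hy, (I.packetAt p hp).perm_one e y⟩
    exact (I.packetAt p hp).possibleImages_subset_hull _ j e hx'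
  price := by rw [vol_print]; exact h₂
  anchor := by rw [vol_print]; exact h₁

/-! ## The three LOCALITY TIERS of the anchor axiom (what the R-H bed can and cannot see)

The bed's nested tiers (AXIS-D1: cell-exact `μ_ex` ⊂ per-place netting `μ_L1a` ⊂ across-place netting `μ_L1b ≡ 1`)
are exactly the three strengths in which an ANCHOR can be PROVED. Typed: -/

/-- PRIME-LOCAL anchoring: `−|log(q)|_p ≤ ln ν̄_{𝕃_p}(R_p)` at every support prime (print's Step (xi) read "prime by
prime"; for print's container this is the per-prime reading `negAbsLogQLoc p ≤ negLogThetaLoc p`, which the tree REFUTES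
at every sufficiently deep prime over a degree-one base: `DHData.not_perPrimeReading_of_ordq_large_of_finrank_eq_one`). -/
def PrimeAnchored {I : ThetaVolumeInput F₀ K} {δ : ℝ} (S : Socket I δ) : Prop :=
  ∀ p ∈ I.supportPrimes, ∀ hp : p.Prime, I.negAbsLogQLoc p ≤ (I.packetAt p hp).lnνLp I.lstar (S.R p hp)

/-- Prime-local anchoring implies the global anchor (product-formula bookkeeping `Summit.ABC.IUTFork.DHData.negAbsLogQ_eq_sum`):
the tiers are NESTED, prime-local being the stronger (more refutable) provenance. -/
theorem anchor_of_primeAnchored {I : ThetaVolumeInput F₀ K} {δ : ℝ} (S : Socket I δ) (h : PrimeAnchored S) :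
    I.negAbsLogQ ≤ vol I S.R := by
  rw [Summit.ABC.IUTFork.DHData.negAbsLogQ_eq_sum I, vol]
  refine Finset.sum_le_sum fun p hpT => ?_
  by_cases hp : p.Prime
  · rw [dif_pos hp]; exact h p hpT hp
  · rw [dif_neg hp, ThetaVolumeInput.negAbsLogQLoc, dif_neg hp]

/-- **The per-prime NO-GO in socket form** (a `Prop`, to be proved by transporting
`DHData.not_perPrimeReading_of_deep`): an inhabitant whose container is prime-locally NO MORE EXPENSIVE than print's
(`ln ν̄_{𝕃_p}(R_p) ≤ negLogThetaLoc p` at each support prime) cannot be prime-anchored at an input with ONE deep prime over a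
degree-one base — whatever its global anchor does. So any alien object that keeps print's T-linear price and is
anchored prime by prime is refuted by actual curves (bed: 196/1,014 · 27/509 · 440/3,392 budget-bound places on
FREY133 · HEX79 · FREY482); only an ESSENTIALLY GLOBAL (trans-prime) anchoring proof survives. -/
def PerPrimeNoGo (I : ThetaVolumeInput F₀ K) (δ : ℝ) : Prop :=
  ∀ S : Socket I δ, (∀ p ∈ I.supportPrimes, ∀ hp : p.Prime,
      (I.packetAt p hp).lnνLp I.lstar (S.R p hp) ≤ I.negLogThetaLoc p) →
    (∃ p ∈ I.supportPrimes, ¬ I.negAbsLogQLoc p ≤ I.negLogThetaLoc p) → ¬ PrimeAnchored S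

/-- `PerPrimeNoGo` is in fact a triviality of order (recorded to show the no-go is bookkeeping, not a conjecture):
a prime where print's per-prime reading fails defeats prime-anchoring of any prime-wise cheaper container. -/
theorem perPrimeNoGo_holds (I : ThetaVolumeInput F₀ K) (δ : ℝ) : PerPrimeNoGo I δ := by
  intro S hcheap ⟨p, hpT, hfail⟩ hanch
  by_cases hp : p.Prime
  · exact hfail ((hanch p hpT hp).trans (hcheap p hpT hp))
  · apply hfail
    rw [ThetaVolumeInput.negAbsLogQLoc, dif_neg hp, ThetaVolumeInput.negLogThetaLoc, dif_neg hp]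

/-! ## The COSTUME LEMMA (carrier-free the socket is the squeeze itself)

With `R` a free field the socket has NO content beyond `gap ≤ δ`: the container `hull(q-region ∪ Θ-region)` with the
trivial declared group inhabits it as soon as `gap ≤ δ` (concretely `Θ-cell ⊆ q-cell` since `ord t_Θ,j = j²·ord(q)/(2l) ≥
ord t_q = ord(q)/(2l)`, the `q`-region is hull-closed in `realPrimePacketM`, and `ln ν̄_{𝕃_p}(q-region_p) = −Q_p`,
`DHData.lnνLp_region_tq_eq`). Stated as a `Prop` (the concrete-packet computation is not redone in this sketch): -/
def CostumeLemma (I : ThetaVolumeInput F₀ K) (δ : ℝ) : Prop :=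
  Nonempty (Socket I δ) ↔ LgpDivisor.ndegLgp I.X.thetaPilot - FinDivisor.ndeg F₀ I.X.qPilot ≤ δ

/-- The proved half of the costume lemma. -/
theorem costume_mp (I : ThetaVolumeInput F₀ K) (δ : ℝ) (h : Nonempty (Socket I δ)) :
    LgpDivisor.ndegLgp I.X.thetaPilot - FinDivisor.ndeg F₀ I.X.qPilot ≤ δ :=
  h.elim fun S => gap_le_of_socket S

/-! ## FIRST LEMMA of the line (the typed resplit the card proposes — sufficient-route rule, no new route)

The U-line's pair (ANCHOR for print's container on the Szpiro-bad locus, PRICE `B_III` above it) is replaced by ONE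
socket item per bad admissible datum; the tail is unchanged (`gap_le_arch_of_socket` feeds the squeeze exactly as
`gap_le_of_cor312Of_of_hullEstimateOf` does). Signature of the first checkable statement, over existing declarations: -/
def SocketAt (I : ThetaVolumeInput F₀ K) (δ : ℝ) : Prop := Nonempty (Socket I δ)

/-- First lemma (bookkeeping, proved): a socket inhabitant at price `δ` yields the U-line's squeeze hypothesis at `I`. -/
theorem squeeze_of_socketAt {I : ThetaVolumeInput F₀ K} {δ : ℝ} (h : SocketAt I δ) :
    LgpDivisor.ndegLgp I.X.thetaPilot - FinDivisor.ndeg F₀ I.X.qPilot ≤ δ + ThetaVolumeInput.archLogTheta I.l :=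
  h.elim fun S => gap_le_arch_of_socket S

/-! # v2 (abc-iut-idea-8 gen 2) — THE COSTUME LEMMA IN THE KERNEL, and the TWO DOORS of the socket

Gen 0 left `CostumeLemma` (⇐) STATED. Below it is PROVED for every genuine Θ-volume input: the `q`-container
`O_𝕃(−div t_q)` — no indeterminacy declared at all (`G := ⊥`) — is a legitimate inhabitant (admissible, hull-closed,
Θ-generated since `‖t_Θ,j‖ ≤ ‖t_q‖`, i.e. `P_q ≤ P_{Θ,j}`) whose ANCHOR holds with equality and whose PRICE is literally the
squeeze `gap ≤ δ`. So `Nonempty (Socket I δ) ↔ gap(I) ≤ δ`: with a free carrier the six socket axioms carry no content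
beyond the Szpiro-type squeeze at the datum. The `theorem`s are bookkeeping; no side is taken on [IUTchIII] Cor. 3.12. -/

/-- Pilot regions are admissible in ANY prime packet (`peel` of `O`, or `O`). -/
theorem adm_pilotRegion_any {F : Type} [Field F] [NumberField F] {p : ℕ} (Q : PrimePacket F p) {lstar : ℕ}
    (t : Fin lstar → (v : placesOver F p) → Q.Λ v) (j : ℕ) (e : Fin (j + 1) → placesOver F p) :
    Q.adm (Q.pilotRegion t j e) := by
  unfold PrimePacket.pilotRegion
  split_ifs with h
  · exact Q.peel_adm _ (Q.O_adm j e)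
  · exact Q.O_adm j e

section PacketFacts

variable {F : Type} [Field F] [NumberField F] (p : ℕ) [Fact p.Prime] (𝔽 : LocalFields F p)
  (c : (j : ℕ) → (Fin (j + 1) → placesOver F p) → ℚ_[p]) (hc0 : ∀ j e, c j e ≠ 0)
  (hcσ : ∀ (j : ℕ) (σ : Equiv.Perm (Fin (j + 1))) (e : Fin (j + 1) → placesOver F p), c j (e ∘ σ) = c j e)

/-- Pilot regions of the real tensor packet are HULL-CLOSED: they are translates `ι_j(t)·(R_I)^∼` of the integral
structure (or `(R_I)^∼` itself), and translates of `(R_I)^∼` are their own holomorphic hull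
(`packetHull_smul_normalizedPacket`, [IUTchIII] Rmk. 3.9.5 (i)). -/
theorem realPrimePacketWith_hullLoc_pilotRegion {lstar : ℕ} (t : Fin lstar → (v : placesOver F p) → (𝔽.k v)ˣ)
    (j : ℕ) (e : Fin (j + 1) → placesOver F p) :
    (realPrimePacketWith p 𝔽 c hc0 hcσ).hullLoc j e ((realPrimePacketWith p 𝔽 c hc0 hcσ).pilotRegion t j e) =
      (realPrimePacketWith p 𝔽 c hc0 hcσ).pilotRegion t j e := by
  unfold PrimePacket.pilotRegion
  split_ifs with h
  · rw [realPrimePacketWith_peel_image', realPrimePacketWith_O']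
    exact packetHull_smul_normalizedPacket p (fun i => 𝔽.k (e i)) _
  · rw [realPrimePacketWith_O']
    exact packetHull_normalizedPacket p (fun i => 𝔽.k (e i))

/-- NESTED pilot regions: if `‖t_i(v)‖ ≤ ‖t'_i(v)‖` at every slot then `O_𝕃(−div t) ⊆ O_𝕃(−div t')` summand by
summand (translates of `(R_I)^∼` compared coordinatewise, `smul_normalizedPacket_subset_smul_normalizedPacket_iff`). -/
theorem realPrimePacketWith_pilotRegion_subset_of_norm_le {lstar : ℕ}
    (t t' : Fin lstar → (v : placesOver F p) → (𝔽.k v)ˣ)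
    (h : ∀ i v, ‖(t i v : 𝔽.k v)‖ ≤ ‖(t' i v : 𝔽.k v)‖) (j : ℕ) (e : Fin (j + 1) → placesOver F p) :
    (realPrimePacketWith p 𝔽 c hc0 hcσ).pilotRegion t j e ⊆
      (realPrimePacketWith p 𝔽 c hc0 hcσ).pilotRegion t' j e := by
  unfold PrimePacket.pilotRegion
  split_ifs with hj
  · rw [realPrimePacketWith_peel_image', realPrimePacketWith_peel_image', realPrimePacketWith_O']
    refine (smul_normalizedPacket_subset_smul_normalizedPacket_iff p (fun i => 𝔽.k (e i)) fun J => ?_).mpr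
      fun J => ?_
    · exact dEquiv_iota_ne_zero p (fun i => 𝔽.k (e i)) (Fin.last j) (t' _ _).ne_zero J
    · rw [norm_dEquiv_iota, norm_dEquiv_iota]
      exact h _ _
  · exact subset_rfl

/-- `ord_v(b) ≤ ord_v(a) ⟹ ‖a‖ ≤ ‖b‖` for units of `K_{v̲}` (`ord_v(x) = −e_v·log‖x‖/log p`). -/
theorem norm_le_of_ordv_le {v : placesOver F p} (a b : (𝔽.k v)ˣ) (h : 𝔽.ordv b ≤ 𝔽.ordv a) :
    ‖(a : 𝔽.k v)‖ ≤ ‖(b : 𝔽.k v)‖ := by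
  have hp1 : (1 : ℝ) < p := by exact_mod_cast (Fact.out : p.Prime).one_lt
  have hlogp : 0 < Real.log p := Real.log_pos hp1
  have he : (0 : ℝ) < ramIdx F v.1 := by exact_mod_cast Nat.pos_of_ne_zero (ramIdx_ne_zero F v.1)
  have ha : 0 < ‖(a : 𝔽.k v)‖ := norm_pos_iff.mpr a.ne_zero
  have hb : 0 < ‖(b : 𝔽.k v)‖ := norm_pos_iff.mpr b.ne_zero
  rw [← Real.log_le_log_iff ha hb]
  unfold LocalFields.ordv at h
  rw [div_le_div_iff_of_pos_right hlogp] at h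
  nlinarith

end PacketFacts

/-- `P_q ≤ P_{Θ,j}` coefficientwise (`P_{Θ,j} = j²·P_q`, `P_q ≥ 0`). -/
theorem qPilot_le_thetaPilot (X : PilotData F₀) (i : Fin X.lstar) (v : HeightOneSpectrum (𝓞 F₀)) :
    X.qPilot v ≤ X.thetaPilot i v := by
  classical
  have hq : 0 ≤ X.qPilot v := by
    show 0 ≤ (∑ w ∈ X.S, FinDivisor.of w ((X.ordq w : ℝ) / (2 * X.l))) v
    rw [Finsupp.finsetSum_apply]
    refine Finset.sum_nonneg fun w hw => ?_
    rw [FinDivisor.of, Finsupp.single_apply]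
    split_ifs
    · have := X.ordq_pos hw
      have := X.two_mul_l_pos
      positivity
    · exact le_rfl
  rw [X.thetaPilot_eq_smul, Finsupp.smul_apply, smul_eq_mul]
  have h1 : (1 : ℝ) ≤ ((i : ℕ) + 1 : ℝ) ^ 2 := by
    have h0 : (0 : ℝ) ≤ (i : ℕ) := Nat.cast_nonneg _
    nlinarith
  nlinarith

/-- Slotwise `‖t_Θ,j(v)‖ ≤ ‖t_q(v)‖` for the two ideles of a genuine input (`ord t_Θ,j = P_{Θ,j}(v) ≥ P_q(v) = ord t_q`). -/
theorem norm_tΘ_le_norm_tq (I : ThetaVolumeInput F₀ K) (p : ℕ) (hp : p.Prime) (i : Fin I.X.lstar)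
    (v : placesOver F₀ p) :
    ‖((I.tΘ p hp i v : _) : @LocalFields.k F₀ _ _ p ⟨hp⟩ (I.σ.localFieldFamily p hp) v)‖ ≤
      ‖((I.tq p hp i v : _) : @LocalFields.k F₀ _ _ p ⟨hp⟩ (I.σ.localFieldFamily p hp) v)‖ := by
  haveI : Fact p.Prime := ⟨hp⟩
  refine norm_le_of_ordv_le p (I.σ.localFieldFamily p hp) _ _ ?_
  rw [I.tΘ_ord p hp i v, I.tq_ord p hp i v]
  exact qPilot_le_thetaPilot I.X i v.1

/-- **THE `q`-CONTAINER** (door A): `O_𝕃(−div t_q)_p` at every prime — the `q`-pilot region, no indeterminacy declared. -/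
def qContainer (I : ThetaVolumeInput F₀ K) : Container I :=
  fun p hp => (I.packetAt p hp).pilotRegion (I.tq p hp)

/-- Its log-volume IS `−|log(q)|` (Thm. 3.10.1 bookkeeping, `DHData.negAbsLogQ_eq_sum`): the anchor holds with EQUALITY. -/
theorem vol_qContainer (I : ThetaVolumeInput F₀ K) : vol I (qContainer I) = I.negAbsLogQ := by
  rw [Summit.ABC.IUTFork.DHData.negAbsLogQ_eq_sum I, vol]
  refine Finset.sum_congr rfl fun p _ => ?_
  by_cases hp : p.Prime
  · rw [dif_pos hp, I.negAbsLogQLoc_of_prime hp]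
    rfl
  · rw [dif_neg hp, ThetaVolumeInput.negAbsLogQLoc, dif_neg hp]

/-- In the genuine packet of an input the Θ-region lies in the `q`-region, summand by summand. -/
theorem thetaRegion_subset_qContainer (I : ThetaVolumeInput F₀ K) (p : ℕ) (hp : p.Prime) (j : ℕ)
    (e : Fin (j + 1) → placesOver F₀ p) :
    (I.packetAt p hp).pilotRegion (I.tΘ p hp) j e ⊆ qContainer I p hp j e := by
  haveI : Fact p.Prime := ⟨hp⟩
  exact realPrimePacketWith_pilotRegion_subset_of_norm_le p (I.σ.localFieldFamily p hp)
    (mScale p (I.σ.localFieldFamily p hp)) (mScale_ne_zero p _) (mScale_perm p _) (I.tΘ p hp) (I.tq p hp)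
    (fun i v => norm_tΘ_le_norm_tq I p hp i v) j e

/-- **DOOR A INHABITANT — the costume**: given only the squeeze `gap(I) ≤ δ`, the `q`-container with the TRIVIAL declared
group fills all six socket axioms (S1)–(S6). -/
def socketOfQ (I : ThetaVolumeInput F₀ K) {δ : ℝ}
    (hgap : LgpDivisor.ndegLgp I.X.thetaPilot - FinDivisor.ndeg F₀ I.X.qPilot ≤ δ) : Socket I δ where
  R := qContainer I
  adm p hp j e := adm_pilotRegion_any (I.packetAt p hp) (I.tq p hp) j e
  hull_closed p hp j e := by
    haveI : Fact p.Prime := ⟨hp⟩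
    exact realPrimePacketWith_hullLoc_pilotRegion p (I.σ.localFieldFamily p hp)
      (mScale p (I.σ.localFieldFamily p hp)) (mScale_ne_zero p _) (mScale_perm p _) (I.tq p hp) j e
  theta_subset p hp j e := thetaRegion_subset_qContainer I p hp j e
  G _ _ _ _ := ⊥
  orbit_subset p hp j e g hg := by
    rw [Subgroup.mem_bot] at hg
    subst hg
    rw [one_smul]
    exact thetaRegion_subset_qContainer I p hp j e
  price := by
    rw [vol_qContainer]
    unfold ThetaVolumeInput.negAbsLogQ
    linarith
  anchor := by rw [vol_qContainer]

/-- The missing half of the costume lemma, now PROVED. -/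
theorem costume_mpr (I : ThetaVolumeInput F₀ K) (δ : ℝ)
    (h : LgpDivisor.ndegLgp I.X.thetaPilot - FinDivisor.ndeg F₀ I.X.qPilot ≤ δ) : Nonempty (Socket I δ) :=
  ⟨socketOfQ I h⟩

/-- **COSTUME LEMMA (kernel)**: for every genuine input and every `δ`, the socket is inhabited iff the squeeze holds. -/
theorem costumeLemma_holds (I : ThetaVolumeInput F₀ K) (δ : ℝ) : CostumeLemma I δ :=
  ⟨costume_mp I δ, costume_mpr I δ⟩

/-! ## TWO DOORS AND NO THIRD (requirement-side reading of the socket)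

Split the socket's two load-bearing axioms over a container `R`: PRICE `vol R ≤ −deĝ̲_lgp(P_Θ) + δ` and ANCHOR
`−|log(q)| ≤ vol R`. `vol R` is ONE real number, so for every container the price slack and the anchor slack sum to
`δ − gap` (`slack_identity`): whatever an object makes PROVABLE on one side it must leave OPEN on the other, up to the
full Szpiro-type content `gap ≤ δ`. The two extreme doors are the tree's two containers:
* DOOR P (print): `R = hull(U_Θ)`; PRICE = `HullEstimateOf` — a THEOREM for every genuine input with the explicit
  `δ_Σ(I)` (`DHData.hullEstimateOf_ofInput`); ANCHOR = `Cor312NonarchOf` — the disputed identification, asserted nowhere;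
* DOOR A (classical): `R = O_𝕃(−div t_q)`; ANCHOR = equality (trivial); PRICE ⟺ `gap ≤ δ` — a height UPPER bound, i.e.
  the Diophantine theorem itself.
An "alien identification object" is a container plus a uniform proof of ONE of the two axioms; the other is then exactly
as hard as the squeeze minus what the first gave. -/

/-- PRICE axiom of a container at discrepancy `δ`. -/
def Price (I : ThetaVolumeInput F₀ K) (R : Container I) (δ : ℝ) : Prop :=
  vol I R ≤ -LgpDivisor.ndegLgp I.X.thetaPilot + δ

/-- ANCHOR axiom of a container (global form). -/
def Anchor (I : ThetaVolumeInput F₀ K) (R : Container I) : Prop := I.negAbsLogQ ≤ vol I R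

/-- The gap `deĝ̲_lgp(P_Θ) − deĝ̲(P_q)` of the input (the quantity the squeeze bounds). -/
def gapOf (I : ThetaVolumeInput F₀ K) : ℝ := LgpDivisor.ndegLgp I.X.thetaPilot - FinDivisor.ndeg F₀ I.X.qPilot

/-- NO THIRD DOOR: anchor slack + price slack = `δ − gap`, for EVERY container. -/
theorem slack_identity (I : ThetaVolumeInput F₀ K) (R : Container I) (δ : ℝ) :
    (vol I R - I.negAbsLogQ) + (-LgpDivisor.ndegLgp I.X.thetaPilot + δ - vol I R) = δ - gapOf I := by
  unfold ThetaVolumeInput.negAbsLogQ gapOf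
  ring

/-- Anchoring is upward-closed in the volume, pricing downward-closed: the admissible volumes form the interval
`[−|log(q)|, −deĝ̲_lgp(P_Θ) + δ]`, non-empty iff `gap ≤ δ`. -/
theorem anchor_mono {I : ThetaVolumeInput F₀ K} {R R' : Container I} (h : vol I R ≤ vol I R') :
    Anchor I R → Anchor I R' := fun hA => hA.trans h

theorem price_anti {I : ThetaVolumeInput F₀ K} {R R' : Container I} {δ : ℝ} (h : vol I R ≤ vol I R') :
    Price I R' δ → Price I R δ := fun hP => h.trans hP

theorem exists_priced_anchored_iff (I : ThetaVolumeInput F₀ K) (δ : ℝ) :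
    (∃ R : Container I, Price I R δ ∧ Anchor I R) ↔ gapOf I ≤ δ := by
  constructor
  · rintro ⟨R, hP, hA⟩
    unfold Price at hP
    unfold Anchor ThetaVolumeInput.negAbsLogQ at hA
    unfold gapOf
    linarith
  · intro h
    refine ⟨qContainer I, ?_, (vol_qContainer I).ge⟩
    unfold Price
    rw [vol_qContainer]
    unfold ThetaVolumeInput.negAbsLogQ
    unfold gapOf at h
    linarith

/-- DOOR A: the `q`-container is anchored for free … -/
theorem anchor_qContainer (I : ThetaVolumeInput F₀ K) : Anchor I (qContainer I) := (vol_qContainer I).ge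

/-- … and its price IS the squeeze (a height upper bound: the Diophantine content, undivided). -/
theorem price_qContainer_iff (I : ThetaVolumeInput F₀ K) (δ : ℝ) : Price I (qContainer I) δ ↔ gapOf I ≤ δ := by
  unfold Price gapOf
  rw [vol_qContainer]
  unfold ThetaVolumeInput.negAbsLogQ
  constructor <;> intro h <;> linarith

/-- DOOR P: print's container is priced by the tree's computable half … -/
theorem price_printContainer_iff (I : ThetaVolumeInput F₀ K) (δ : ℝ) :
    Price I (printContainer I) δ ↔ I.HullEstimateOf δ := by
  unfold Price
  rw [vol_print]
  rfl

/-- … for every genuine input with the explicit discrepancy `δ_Σ(I)` (a THEOREM of the tree, nothing assumed) … -/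
theorem price_printContainer_explicit (I : ThetaVolumeInput F₀ K) :
    Price I (printContainer I) (Summit.ABC.IUTFork.DHData.explicitDelta I) :=
  (price_printContainer_iff I _).mpr (Summit.ABC.IUTFork.DHData.hullEstimateOf_ofInput I)

/-- … and its anchor IS the disputed claim (Dupuy–Hilado (1.1) / [IUTchIII] Cor. 3.12 nonarchimedean form), asserted nowhere. -/
theorem anchor_printContainer_iff (I : ThetaVolumeInput F₀ K) :
    Anchor I (printContainer I) ↔ I.Cor312NonarchOf := by
  unfold Anchor
  rw [vol_print]
  rfl

/-- Hence at door P the whole open content is the anchor: `Cor312NonarchOf I → gap(I) ≤ δ_Σ(I)` (the tree's squeeze, re-derived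
through the socket), while at door A the whole open content is the price. -/
theorem gap_le_explicitDelta_of_anchor_print (I : ThetaVolumeInput F₀ K) (h : I.Cor312NonarchOf) :
    gapOf I ≤ Summit.ABC.IUTFork.DHData.explicitDelta I :=
  (exists_priced_anchored_iff I _).mp
    ⟨printContainer I, price_printContainer_explicit I, (anchor_printContainer_iff I).mpr h⟩

end Summit.ABC.ABC.Cruxes.ThetaPartII.IdentificationSocket

end
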